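import Literature.AlgebraicGeometry.HodgeTheory.UnitaryReflectionLieClosure
import Literature.AlgebraicGeometry.HodgeTheory.UnitaryReflectionRealTransfer
import HarnessLib

/-!
# Carlson–Toledo's density theorem for unitary reflection groups HOLDS: discharge of the named fact
# `carlsonToledo1999_unitaryReflection_zariskiDense` (Carlson–Toledo 1999 §7, Theorem `udensitytheo`) by an
# algebraic proof

Family `hodge`, layer `Literature/AlgebraicGeometry/HodgeTheory`. THEOREM only: the `_holds` companion of the
named fact of `UnitaryReflectionGroupZariskiDense` ("a subgroup of `U(p,q)` generated by complex
`λ`-reflections of finite order along one orbit of unit vectors spanning `ℂ(p,q)`, `p + q > 1`, `λ ≠ ±1`, is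
finite or `PΓ` is Zariski-dense in `PU(p,q)`", Duke Math. J. 97 (1999) §7). The printed proof is
semi-algebraic (orbits with non-empty interior in the unit quadric, the hyperbolic plane, pencils of
hyperplanes); the proof assembled here is ALGEBRAIC and runs through the Lie algebra of the Zariski closure:

1. `UnitaryReflectionLieProjector` / `…LieIrreducible` / `…LieCore` — the Lie core: for a reflection system,
   the only non-zero `Ad(Γ)`-stable Lie subalgebra of `𝔰𝔩(W)` is `𝔰𝔩(W)` (component closure in the
   `Ad(s_δ)`-eigenvalues `1, λ, λ⁻¹`; Schur; `W` is `L`-irreducible; `ℂδ + Lδ` is `L`-stable);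
2. `UnitaryReflectionLieClosure` — with the algebraic-group dictionary of `Literature/NumberTheory/Automorphic`
   (`dim Lie = dim H°`, `Lie` of finite-index subgroups, exponentials of nilpotents) an INFINITE such `Γ` has
   `SL(W) ⊆ (Γ^Zar)°(ℂ)`;
3. `UnitaryReflectionRealTransfer` — the unit scalars have all scalars in their complex closure, so
   `GL(W) = ℂˣ·SL(W) ⊆ (Γ·U(1))^Zar(ℂ)`, and for the UNITARY group `Γ·U(1)` complex-closure membership of a
   unitary `u` transfers to real-closure membership of its real points (`ḡ = H g⁻¹ H⁻¹` on `U(h)`).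

Hence the conclusion of the fact on real points: `Γ` finite, or `U(W,h) ⊆ (Γ·U(1))^Zar(ℝ)`. Consumers (all
by name): `UnitaryReflectionPairInfinite`, `UnitaryReflectionCommutatorsZariski`,
`UnitaryCommutatorsIdentityComponent`, and the conditional closings of crux K1 `VeryGeneralDeckCommutatorsInHg`
of `Summits/HodgeConjecture/HodgeConjecture/Theses/CyclicUnitaryPowers.lean` (`Theorems/CyclicUnitaryPowersFiveFacts`,
`…LaneDCommutatorClosure`, `…DeckHodgeOfGriffiths`). Written by the prover seat `hodge-nonav-prover-Bx` (cell
`hodge-nonav`, `stmt-HodgeConjecture-19544`).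

## References
* [CarlsonToledo1999] J. A. Carlson, D. Toledo, *Discriminant complements and kernels of monodromy
  representations*, Duke Math. J. 97 (1999) 621–648, §7 Theorem `udensitytheo` (arXiv alg-geom/9708002
  pp. 15–16).
* [Deligne1980] P. Deligne, *La conjecture de Weil. II*, Publ. Math. IHÉS 52 (1980), §4.4 (the model).
* [Borel1991] A. Borel, *Linear Algebraic Groups*, 2nd ed. (1991), I.2.1–2.4, AG §§11–14.
-/

noncomputable section

open Module Literature.AlgebraicGeometry.Motives
open scoped ComplexConjugate

namespace Literature.AlgebraicGeometry.HodgeTheory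

/-- **Carlson–Toledo 1999, §7, Theorem `udensitytheo` — PROVED** (discharge of the named fact
`carlsonToledo1999_unitaryReflection_zariskiDense`): "Let `ε = ±1` be fixed, and let `Δ` be a set of
vectors in a hermitian space `ℂ(p,q)` which lie in the unit quadric `h(δ,δ) = ε`. Fix a root of unity
`λ ≠ ±1` and let `Γ` be the subgroup of `U(p,q)` generated by the complex reflections
`s_δ(x) = x + ε(λ − 1)h(x,δ)δ` for all `δ` in `Δ`. Suppose that `p + q > 1`, that `Δ` consists of a single
`Γ`-orbit, and that `Δ` spans `ℂ(p,q)`. Then either `Γ` is finite or `PΓ` Zariski-dense in `PU(p,q)`." —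
in the tree's rendering: `Γ` finite, or every `h`-unitary `u` has real points in
`glZariskiClosure (realPointsWithUnitScalars W Γ)`. Algebraic proof via the Lie core
(`mem_glIdentityComponent_of_det_eq_one_of_infinite`: `SL(W) ⊆ (Γ^Zar)°(ℂ)` for infinite `Γ`), the scalars
(`mem_glZariskiClosure_of_forall_apply_eq_smul`) and the unitary transfer
(`restrictScalarsRealHom_mem_glZariskiClosure_of_unitary`). [cite: CarlsonToledo1999, §7 Theorem udensitytheo] -/
theorem carlsonToledo1999_unitaryReflection_zariskiDense_holds :
    carlsonToledo1999_unitaryReflection_zariskiDense := by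
  intro W _ _ _ B hB hBn hW ε hε l hlN hl1 hl2 Δ hΔ hspan Γ hΓ _hstab htrans
  classical
  by_cases hfin : (Γ : Set (W ≃ₗ[ℂ] W)).Finite
  · exact Or.inl hfin
  refine Or.inr fun u hu => ?_
  obtain ⟨hε', hεr⟩ := sign_mul_self_and_conj hε
  obtain ⟨N, hNpos, hlN'⟩ := hlN
  have hll : conj l * l = 1 := conj_mul_self_eq_one_of_pow_eq_one hNpos hlN'
  -- the unit scalars and `Δc = Γ ⊔ Sc`
  set Sc : Subgroup (W ≃ₗ[ℂ] W) :=
    Subgroup.closure {g : W ≃ₗ[ℂ] W | ∃ z : ℂ, ‖z‖ = 1 ∧ ∀ x, g x = z • x} with hSc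
  set Δc : Subgroup (W ≃ₗ[ℂ] W) := Γ ⊔ Sc with hΔc
  -- every unit scalar is realised in `Sc`
  have hunit : ∀ z : ℂ, ‖z‖ = 1 → ∃ g ∈ Δc, ∀ x, g x = z • x := by
    intro z hz
    have hz0 : z ≠ 0 := fun h => by rw [h, norm_zero] at hz; exact zero_ne_one hz
    refine ⟨Units.mk0 z hz0 • (1 : W ≃ₗ[ℂ] W), Subgroup.mem_sup_right (Subgroup.subset_closure
      ⟨z, hz, fun x => ?_⟩), fun x => ?_⟩ <;>
    rw [LinearEquiv.smul_apply, Units.val_mk0] <;> rfl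
  -- (1) `u` lies in the complex closure of `Δc`: `u = (c·1) · v`, `det v = 1`
  have h1 : u ∈ glZariskiClosure Δc := by
    set n := finrank ℂ W with hn
    have hnpos : 0 < n := lt_of_lt_of_le (by norm_num) hW
    obtain ⟨c, hc⟩ := IsAlgClosed.exists_pow_nat_eq ((LinearEquiv.det u : ℂˣ) : ℂ) hnpos
    have hc0 : c ≠ 0 := by
      rintro rfl
      rw [zero_pow hnpos.ne'] at hc
      exact (LinearEquiv.det u).ne_zero hc.symm
    set s : W ≃ₗ[ℂ] W := Units.mk0 c hc0 • (1 : W ≃ₗ[ℂ] W) with hs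
    have hs_apply : ∀ x, s x = c • x := fun x => by rw [hs, LinearEquiv.smul_apply, Units.val_mk0]; rfl
    have hs_coe : (s : W →ₗ[ℂ] W) = c • LinearMap.id := by ext x; simp [hs_apply]
    have hdet_s : LinearEquiv.det s = LinearEquiv.det u := by
      apply Units.ext
      rw [LinearEquiv.coe_det, hs_coe, LinearMap.det_smul, LinearMap.det_id, mul_one, ← hn, hc]
    set v : W ≃ₗ[ℂ] W := s⁻¹ * u with hv
    have hdet_v : LinearEquiv.det v = 1 := by
      rw [hv, map_mul, map_inv, hdet_s, inv_mul_cancel]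
    have hvmem : v ∈ glZariskiClosure Δc :=
      glZariskiClosure_mono (le_sup_left : Γ ≤ Δc) (glIdentityComponent_subset_glZariskiClosure Γ
        (mem_glIdentityComponent_of_det_eq_one_of_infinite hBn hW hε ⟨N, hNpos, hlN'⟩ hl1 hl2 hΔ hspan hΓ
          htrans hfin hdet_v))
    have hsmem : s ∈ glZariskiClosure Δc := mem_glZariskiClosure_of_forall_apply_eq_smul hunit hs_apply
    have huv : u = s * v := by rw [hv, ← mul_assoc, mul_inv_cancel, one_mul]
    rw [huv]
    exact mul_mem_glZariskiClosure hsmem hvmem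
  -- (2) every element of `Δc` is unitary
  let U : Subgroup (W ≃ₗ[ℂ] W) :=
    { carrier := {g | ∀ x y, B (g x) (g y) = B x y}
      one_mem' := fun _ _ => rfl
      mul_mem' := fun {g g'} hg hg' x y => by rw [LinearEquiv.mul_apply, LinearEquiv.mul_apply, hg, hg']
      inv_mem' := fun {g} hg x y => by
        rw [← hg (g⁻¹ x) (g⁻¹ y), linearEquiv_apply_inv_apply, linearEquiv_apply_inv_apply] }
  have hΓU : Γ ≤ U := fun g hg =>
    isometry_of_mem_closure_setOf_coe_eq_complexReflection hB hε' hεr hll hΔ (hΓ ▸ hg)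
  have hScU : Sc ≤ U := by
    rw [hSc, Subgroup.closure_le]
    rintro g ⟨z, hz, hg⟩ x y
    have hzz : conj z * z = 1 := by rw [Complex.conj_mul', hz]; norm_num
    simp only [hg, LinearMap.map_smulₛₗ, LinearMap.smul_apply, map_smul, smul_eq_mul]
    linear_combination (B x y) * hzz
  have h2 : ∀ g ∈ Δc, ∀ x y, B (g x) (g y) = B x y := fun g hg => (sup_le hΓU hScU) hg
  -- (3) transfer to the real points, and (4) compare the real subgroups
  have h3 := restrictScalarsRealHom_mem_glZariskiClosure_of_unitary hBn h2 hu h1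
  have hle : Δc.map (restrictScalarsRealHom W) ≤ realPointsWithUnitScalars W Γ := by
    rw [hΔc, Subgroup.map_sup]
    refine sup_le_sup le_rfl ?_
    rw [hSc, Subgroup.map_le_iff_le_comap, Subgroup.closure_le]
    rintro g ⟨z, hz, hg⟩
    rw [SetLike.mem_coe, Subgroup.mem_comap, mem_unitScalarSubgroup_iff]
    exact ⟨z, hz, fun x => by rw [restrictScalarsRealHom_apply, hg]⟩
  exact glZariskiClosure_mono hle h3

end Literature.AlgebraicGeometry.HodgeTheory
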